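import Summits.BirchSwinnertonDyer.BirchSwinnertonDyer.Theses.SignedLowerHalves
import Summits.BirchSwinnertonDyer.BirchSwinnertonDyer.Theorems.SignedLowerHalvesKobayashiMainConjectureSmallImageSignedMuDefect
import Summits.BirchSwinnertonDyer.Rank1Residual.CoatesSujathaConjectureA
import Literature.NumberTheory.EllipticCurves.IwasawaModuleFinitePadicIntProofs
import HarnessLib

/-!
# Route `SignedLowerHalves`, crux `KobayashiMainConjectureSmallImage` (item stmt-BirchSwinnertonDyer-19002):
# the EULER-SYSTEM `μ`-TRANSFER at NON-SURJECTIVE image, part 7 — `stub_saturationSmallImage` and the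
# crux BY NAME modulo COATES–SUJATHA'S CONJECTURE A instead of the analytic rider
# (cell `bsd-ssimc`, WIDTH-LEVER lane B = seat `bsd-ssimc-k3-c4x` g2; helper file,
# `--supports stmt-BirchSwinnertonDyer-19002 --as helper`; theorems only; imports the route file for
# the crux-by-name closer, like part 5 — keep it a leaf)

HONEST FRAMING.  CONDITIONAL theorems.  Binders displayed and never discharged here: the construction
fact `Kobayashi2003.thm62_63_73_signedColemanKato_zeta` (part 2, p529649), the published facts
Kobayashi Thm. 1.2 (`h12`) / Thm. 4.1 RATIONAL (`h41`) / the period-unit pair (`h5`, `h3`), the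
Eisenstein half (the registered stub `stub_lowerSmallImage`, OPEN, engine-less) where the crux is
concluded, and ONE rider: Coates–Sujatha's CONJECTURE A for `(E, p)` — «the Pontryagin dual of the
fine Selmer group `Sel₀(ℚ_∞, E[p^∞])` is finitely generated over `ℤ_p`» (`μ(X₀(E/ℚ_∞)) = 0`), OPEN,
consumed either as a displayed per-pair hypothesis in the EXACT spelling of the tree's node
`Summit.BirchSwinnertonDyer.Rank1Residual.FineSelmer.CoatesSujathaConjectureA` or as that node BY
NAME.  Nothing is booked; crux 4 stays OPEN; BSD is not proved by any of this.

PARTITION (cell bsd-ssimc): X7 (A7) × item 4's ENTIRE domain — types-the-object-of; closes NONE.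

## Why this rider, and how it compares with parts 3/4

Part 6 (`…SmallImageSignedMuDefect.lean`) proved, rider-free and at any image,
`μ(X^ε) ≤ μ(X₀) + μ(L_p^ε)`.  With `μ(X₀) = 0` this is exactly the displayed inequality `hμle` of
part 4's `kobayashiMainConjecture_of_lengthAt_le_of_lowerDivisibility` (`μ(X^ε) ≤ μ(L_p^ε)`: the
`μ`-part of Kato's divisibility, which at surjective image is Kobayashi Thm. 4.1 with `n = 0`), and
that theorem turns the Eisenstein half into the equality (Thm. 4.1 rational pins `h ∣ pⁿ`; the two
`μ`-bounds force `h ∈ Λˣ`).  Comparison of riders on item 4's domain: parts 3/4's ONE-SIGN analytic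
rider («`L_p^{ε₀}(E)` has a unit coefficient for some `ε₀`», the Perrin-Riou–Pollack `μ`-conjecture
for one sign) IMPLIES Conjecture A for `(E, p)` (part 1's reduction-free core: a genuine Euler-system
class outside `p𝐇¹` gives `μ(X₀) = 0`), so the present rider is WEAKER (logically implied), SIGN-FREE
and `L`-FUNCTION-FREE; it is implied by Iwasawa's classical `μ = 0` conjecture for the cyclotomic
`ℤ_p`-extension of `ℚ(E[p])` (Coates–Sujatha 2005, Thm. 3.4; Kurihara–Pollack 2007 §3.1), a number
field of degree `#ρ̄_{E,p}(Γ_ℚ)` prime to `p` on this domain (lane A, `smallImage_not_dvd_card_image`).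
Per pair the analytic rider remains the certifiable one (lane A's θ-rows); class-wide, Conjecture A is
the natural typed frontier of the saturation half.

## Contents (theorems only)

* §1 `signed_lengthAt_le_of_fine_lengthAt_eq_zero` (`length_(p) X₀ = 0 ⟹ length_(p) X^ε ≤
  length_(p) Λ/(L_p^ε)`), `kobayashiMainConjecture_of_fine_lengthAt_eq_zero_of_lowerDivisibility`,
  `kobayashiMainConjecture_of_conjectureA_of_lowerDivisibility` (rider in the node's spelling; the
  tree's `exists_fineSelmerDualData_moduleFinite_iff_finite_pTorsion` (Lim–Sujatha §3) makes it
  datum-free: `Sel₀(ℚ_∞, E[p^∞])[p]` finite) — ANY image, ANY rank, NO partner.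
* §2 `stub_saturationSmallImage_of_conjectureA` — the REGISTERED stub verbatim modulo the binders +
  Conjecture A on the domain; `stub_saturationSmallImage_of_coatesSujathaConjectureA` — the same from
  the tree node BY NAME.
* §3 `kobayashiMainConjectureSmallImage_of_lower_of_conjectureA` — crux 4 BY NAME ⟸ the registered
  `stub_lowerSmallImage` statement + Conjecture A on the domain + the binders (the analogue of part 5).

References: [Kobayashi2003] Thm. 1.2 (p. 2), Thm. 4.1 (p. 8), Thm. 6.2–6.3 (p. 11), Thm. 7.3–7.4
(p. 13); [Kato2004Asterisque] Thm. 12.6 (p. 222), §17.13 (p. 280); [CoatesSujatha2005] Conjecture A,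
Thm. 3.4; [KuriharaPollack2007] §3.1; [LimSujatha2018] §3; [Washington1997] §13.2; tree: parts 1–6 of
this seat, `Rank1Residual/CoatesSujathaConjectureA.lean` (the node), `IwasawaModuleFinitePadicIntProofs`.
-/

set_option linter.dupNamespace false
set_option autoImplicit false

noncomputable section

open scoped Classical MatrixGroups ModularForm Polynomial

open CongruenceSubgroup WeierstrassCurve Field
  Literature.NumberTheory.EllipticCurves Literature.NumberTheory.EllipticCurves.ModularForms
  Literature.NumberTheory.EllipticCurves.Rank1Residual
  Literature.NumberTheory.EllipticCurves.Kobayashi2003 Literature.NumberTheory.EllipticCurves.Kato2004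
  Literature.NumberTheory.EllipticCurves.GreenbergVatsal2000 ZpExtension
  Literature.NumberTheory.EllipticCurves.IwasawaAlgebra Literature.NumberTheory.EllipticCurves.Module
  Summit.BirchSwinnertonDyer.Rank1Residual.Supersingular
  Summit.BirchSwinnertonDyer.BirchSwinnertonDyer.Rank1Residual
  Summit.BirchSwinnertonDyer.BirchSwinnertonDyer.Theorems.SmallImageSignedMuTransfer

namespace Summit.BirchSwinnertonDyer.BirchSwinnertonDyer.Theorems.SmallImageSignedMuDefect

/-! ### §1 Closers: `μ(X₀) = 0` (Coates–Sujatha's Conjecture A for `(E, p)`) replaces the analytic rider -/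

section Closers

variable (W : WeierstrassCurve ℚ) [W.IsElliptic] [W.IsGloballyMinimal] (p : ℕ) [Fact p.Prime]

/-- **`μ(X₀(E/ℚ_∞)) = 0 ⟹ μ(X^ε) ≤ μ(L_p^ε)` — the `μ`-part of Kato's divisibility for `Sel^ε`, at
ANY image, from the vanishing of the fine `μ`-invariant.**  Odd good `p`, `a_p = 0`, newform `f` with
period ratio `ϖ`, sign-`ε` Pollack function `L`, cyclotomic `(κ, γ)`: if the dual fine Selmer datum
`Y` has `length_(p) X₀ = 0` then every dual datum `D` of `Sel^ε(E/ℚ_∞)` has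
`length_(p) X^ε ≤ length_(p) Λ/(L)` — the displayed inequality `hμle` of
`kobayashiMainConjecture_of_lengthAt_le_of_lowerDivisibility` (part 4, p533653), here WITHOUT any
unit-coefficient rider and WITHOUT `¬Surj`.  Binders: the construction fact `hCK` and the period-unit
pair `h5`/`h3` (to pass from `G₁ = C(ϖ)·L` to `L`; `E[p]` irreducible is derived from `a_p = 0`).
[cite: Kobayashi2003, Thm. 6.3 (p. 11), Thm. 7.3 i) (7.21) and proof of Thm. 7.4 (p. 13)]
[cite: Kato2004Asterisque, §17.13 (p. 280)] [cite: GreenbergVatsal2000, §3 (period unit)] -/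
theorem signed_lengthAt_le_of_fine_lengthAt_eq_zero (hCK : thm62_63_73_signedColemanKato_zeta)
    (h5 : realPeriodRat_eq_unit_mul_plusPeriod) (h3 : realPeriodRat_eq_unit_mul_plusPeriod_three)
    (hp : p ≠ 2) (hgood : W.HasGoodReductionAtPrime p) (hap : W.frobeniusTrace p = 0)
    {N : ℕ} [NeZero N] (f : CuspForm (Gamma0 N) 2) (hf : IsNewformOf W f)
    (ϖ : ℚ) (hϖ : (ϖ : ℝ) * W.realPeriodRat = plusPeriod f)
    {ε : ℤˣ} {L : IwasawaAlgebra p} (hL : IsSignedPAdicLFunction f p ε L)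
    (κ : ZpExtension ℚ p) (γ : absoluteGaloisGroup ℚ) (hκ : κ.IsCyclotomic) (hγ : κ.IsTopGenerator γ)
    (hγ' : IsCyclotomicVariable p γ) (D : SignedSelmerDualData W κ γ ε) (Y : W.FineSelmerDualData κ γ)
    (𝔭 : PrimeSpectrum (IwasawaAlgebra p)) (h𝔭 : 𝔭.asIdeal = augIdealP p)
    (hY : lengthAt (IwasawaAlgebra p) Y.X 𝔭 = 0) :
    lengthAt (IwasawaAlgebra p) D.X 𝔭 ≤
      lengthAt (IwasawaAlgebra p) (IwasawaAlgebra p ⧸ Ideal.span {L}) 𝔭 := by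
  haveI : ContinuousSMul ℤ_[p] (W.tateModule p) := TateModule.continuousSMul_padicInt
  haveI : Module.Free ℤ_[p] (W.tateModule p) := W.module_free_tateModule_holds p
  haveI : Module.Finite ℤ_[p] (W.tateModule p) := W.module_finite_tateModule_holds p
  have hirr : W.HasIrreducibleModPGaloisRep p :=
    hasIrreducibleModPGaloisRep_of_dvd_frobeniusTrace W p hp
      (W.not_dvd_minimalDiscriminantInt_of_hasGoodReductionAtPrime' p hgood) (by rw [hap]; exact dvd_zero _)
  obtain ⟨I⟩ := nonempty_iwasawaH1Data_holds W p κ γ hκ hγ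
  obtain ⟨C⟩ := hCK W p f ϖ κ γ hp hgood hap hf hϖ hκ hγ hγ' ε I
  -- the period unit: `G₁ := C(u)·L` is Néron-normalised and `(G₁) = (L)`
  have hvϖ : padicValRat p ϖ = 0 :=
    Rank1Residual.padicValRat_periodRatio_eq_zero h5 h3 W p hp hgood hirr f hf ϖ hϖ
  have hϖ0 : ϖ ≠ 0 := by
    intro hz
    rw [hz, Rat.cast_zero, zero_mul] at hϖ
    exact (IsNewform0.plusPeriod_pos_holds hf.1 hf.coeffField_eq_bot).ne' hϖ.symm
  obtain ⟨u, hu'⟩ := exists_units_coe_eq_ratCast hϖ0 hvϖ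
  obtain ⟨hspan, hι⟩ := span_C_units_mul_eq u L
  have hG₁ : iwasawaToPowerSeries p (PowerSeries.C (u : ℤ_[p]) * L) =
      PowerSeries.C ((ϖ : ℚ) : ℚ_[p]) * iwasawaToPowerSeries p L := by rw [hι, hu']
  have h𝔭1 : 𝔭.asIdeal.height = 1 := by rw [h𝔭]; exact height_augIdealP_holds p
  have h := signedSelmerDual_lengthAt_le_fine_add W p C hirr hL hG₁ D Y 𝔭 h𝔭1
  rwa [hY, zero_add, hspan] at h

/-- **`lower ⇒ equality` from `μ(X₀) = 0`, any image, any rank, no partner.**  Let `p` be an odd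
good prime of `E = W` with `a_p = 0` and suppose every dual fine Selmer datum over the cyclotomic
tower (cyclotomic `(κ, γ)` matching the cyclotomic variable) has `length_(p) X₀ = 0` (`hA`,
displayed: Coates–Sujatha's Conjecture A for `(E, p)` in the tree's `lengthAt` currency; part 6's
`fine_lengthAt_eq_zero_of_hasUnitContent` derives it from parts 3/4's one-sign analytic rider at
non-surjective image, so this closer's rider is implied by that one).  Granted BY NAME `hCK`, Kobayashi Thm. 1.2 (`h12`), Thm. 4.1 RATIONAL
(`h41`) and the period-unit pair: the Eisenstein half `KobayashiLowerDivisibility W p ε` implies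
`KobayashiMainConjecture W p ε`.  Proof: the previous theorem supplies `hμle` of part 4's
`kobayashiMainConjecture_of_lengthAt_le_of_lowerDivisibility`.
[cite: Kobayashi2003, Thm. 1.2 (p. 2), Thm. 4.1 (p. 8), Thm. 7.3–7.4 (p. 13)] [cite: CoatesSujatha2005, Conjecture A] -/
theorem kobayashiMainConjecture_of_fine_lengthAt_eq_zero_of_lowerDivisibility
    (hCK : thm62_63_73_signedColemanKato_zeta)
    (h12 : Kobayashi2003.thm12_signedSelmerDual_finite_torsion)
    (h41 : Kobayashi2003.thm41_signedCharIdeal_divisibility)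
    (h5 : realPeriodRat_eq_unit_mul_plusPeriod) (h3 : realPeriodRat_eq_unit_mul_plusPeriod_three)
    (hp : p ≠ 2) (hgood : W.HasGoodReductionAtPrime p) (hap : W.frobeniusTrace p = 0)
    (hA : ∀ (κ : ZpExtension ℚ p) (γ : absoluteGaloisGroup ℚ),
      κ.IsCyclotomic → κ.IsTopGenerator γ → IsCyclotomicVariable p γ →
      ∀ (Y : W.FineSelmerDualData κ γ) (𝔭 : PrimeSpectrum (IwasawaAlgebra p)),
        𝔭.asIdeal = augIdealP p → lengthAt (IwasawaAlgebra p) Y.X 𝔭 = 0)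
    {ε : ℤˣ} (hlow : KobayashiLowerDivisibility W p ε) : KobayashiMainConjecture W p ε := by
  refine kobayashiMainConjecture_of_lengthAt_le_of_lowerDivisibility W p h12 h41 h5 h3 hp hgood hap
    ?_ hlow
  intro κ γ hκ hγ hγ' _ f hf ϖ hϖ L hL D 𝔭 h𝔭
  obtain ⟨Y⟩ := W.nonempty_fineSelmerDualData κ hγ
  exact signed_lengthAt_le_of_fine_lengthAt_eq_zero W p hCK h5 h3 hp hgood hap f hf ϖ hϖ hL κ γ hκ hγ
    hγ' D Y 𝔭 h𝔭 (hA κ γ hκ hγ hγ' Y 𝔭 h𝔭)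

/-- **The same closer with Conjecture A in its own spelling** — for the cyclotomic `ℤ_p`-extension
`κ` of `ℚ`, "`Sel₀(E/ℚ_∞)^∨` is a finitely generated `ℤ_p`-module" for SOME dual datum (the tree node
`Rank1Residual.FineSelmer.CoatesSujathaConjectureA` instantiated at `(ℚ, E, p)`): by Lim–Sujatha §3 /
Greenberg §1 (tree `exists_fineSelmerDualData_moduleFinite_iff_finite_pTorsion`) this says
`Sel₀(ℚ_∞, E[p^∞])[p]` is finite, a datum-free statement, whence `X₀/(p)X₀` is finite and
`length_(p) X₀ = 0` for EVERY datum (`KatoMuSkeleton.lengthAt_eq_zero_of_finite_quotient_p`).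
[cite: CoatesSujatha2005, Conjecture A] [cite: LimSujatha2018, §3 (before Prop. 3.2)] [cite: Washington1997, §13.2] -/
theorem kobayashiMainConjecture_of_conjectureA_of_lowerDivisibility
    (hCK : thm62_63_73_signedColemanKato_zeta)
    (h12 : Kobayashi2003.thm12_signedSelmerDual_finite_torsion)
    (h41 : Kobayashi2003.thm41_signedCharIdeal_divisibility)
    (h5 : realPeriodRat_eq_unit_mul_plusPeriod) (h3 : realPeriodRat_eq_unit_mul_plusPeriod_three)
    (hp : p ≠ 2) (hgood : W.HasGoodReductionAtPrime p) (hap : W.frobeniusTrace p = 0)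
    (hA : ∀ (κ : ZpExtension ℚ p), κ.IsCyclotomic →
      ∃ (γ : absoluteGaloisGroup ℚ) (Y : W.FineSelmerDualData κ γ),
        Module.Finite ℤ_[p] (RestrictScalars ℤ_[p] (IwasawaAlgebra p) Y.X))
    {ε : ℤˣ} (hlow : KobayashiLowerDivisibility W p ε) : KobayashiMainConjecture W p ε := by
  refine kobayashiMainConjecture_of_fine_lengthAt_eq_zero_of_lowerDivisibility W p hCK h12 h41 h5 h3
    hp hgood hap ?_ hlow
  intro κ γ hκ hγ _ Y 𝔭 h𝔭
  have hfin : Set.Finite {s : W.fineSelmerInfty κ | p • s = 0} :=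
    (IwasawaModuleFinitePadicInt.exists_fineSelmerDualData_moduleFinite_iff_finite_pTorsion W κ hγ).mp
      (hA κ hκ)
  haveI : Module.Finite (IwasawaAlgebra p) Y.X := Y.module_finite_of_finite_pTorsion hγ hfin
  haveI : Finite (Y.X ⧸ (augIdealP p • (⊤ : Submodule (IwasawaAlgebra p) Y.X))) :=
    Y.finite_quotient_augIdealP_of_finite_pTorsion hfin
  exact KatoMuSkeleton.lengthAt_eq_zero_of_finite_quotient_p (M := Y.X) 𝔭 h𝔭

end Closers

/-! ### §2 The REGISTERED stub `stub_saturationSmallImage` modulo Coates–Sujatha's Conjecture A -/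

/-- **The REGISTERED stub `stub_saturationSmallImage` for EVERY sign modulo Coates–Sujatha's
Conjecture A on item 4's domain** (skeleton `Lines/birth.lean`, sha16 b1bf5b11c746572b; conclusion
verbatim).  Binders = the construction fact `hCK` (p529649), the published `h12`, `h41` (rational),
`h5`, `h3`, and the class-wide rider `hA` = the tree node `FineSelmer.CoatesSujathaConjectureA`
instantiated at every `(ℚ, E, p)` of item 4's domain («the dual fine Selmer group over `ℚ_∞` is
finitely generated over `ℤ_p`», OPEN; implied by Iwasawa's `μ = 0` for `ℚ(E[p])^{cyc}`,
Coates–Sujatha Thm. 3.4; implied on this domain by the one-sign analytic rider of parts 3/4 through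
part 1's core) — a SIGN-FREE, `L`-function-free rider, weaker than the analytic one.  NO partner, NO
congruence, NO preprint, NO `Surj`/(12.5.2)/τ; nothing booked; crux 4 stays OPEN (Eisenstein half
engine-less). [cite: Kobayashi2003, Thm. 1.2 (p. 2), Thm. 4.1 (p. 8), Thm. 6.2–6.3 (p. 11), Thm. 7.3–7.4 (p. 13)]
[cite: Kato2004Asterisque, Thm. 12.6 (p. 222), §17.13 (p. 280)] [cite: CoatesSujatha2005, Conjecture A and Thm. 3.4] -/
theorem stub_saturationSmallImage_of_conjectureA (hCK : thm62_63_73_signedColemanKato_zeta)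
    (h12 : Kobayashi2003.thm12_signedSelmerDual_finite_torsion)
    (h41 : Kobayashi2003.thm41_signedCharIdeal_divisibility)
    (h5 : realPeriodRat_eq_unit_mul_plusPeriod) (h3 : realPeriodRat_eq_unit_mul_plusPeriod_three)
    (hA : ∀ (W : WeierstrassCurve ℚ) [W.IsElliptic] [W.IsGloballyMinimal] (p : ℕ) [Fact p.Prime],
      p ≠ 2 → ClassX7 W p → ¬ W.HasCM → W.frobeniusTrace p = 0 → ¬ Surj W p →
      ∀ (κ : ZpExtension ℚ p), κ.IsCyclotomic →
        ∃ (γ : absoluteGaloisGroup ℚ) (Y : W.FineSelmerDualData κ γ),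
          Module.Finite ℤ_[p] (RestrictScalars ℤ_[p] (IwasawaAlgebra p) Y.X)) :
    ∀ (W : WeierstrassCurve ℚ) [W.IsElliptic] [W.IsGloballyMinimal] (p : ℕ) [Fact p.Prime],
      p ≠ 2 → ClassX7 W p → ¬ W.HasCM → W.frobeniusTrace p = 0 → ¬ Surj W p →
      ∀ ε : ℤˣ, Summit.BirchSwinnertonDyer.Rank1Residual.Supersingular.KobayashiLowerDivisibility W p ε →
        Summit.BirchSwinnertonDyer.Rank1Residual.Supersingular.KobayashiMainConjecture W p ε := by
  intro W _ _ p _ hp hX hcm hap hs ε hlow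
  exact kobayashiMainConjecture_of_conjectureA_of_lowerDivisibility W p hCK h12 h41 h5 h3 hp hX.1.1 hap
    (hA W p hp hX hcm hap hs) hlow

/-- **The REGISTERED stub modulo the tree's conjecture node BY NAME**: `stub_saturationSmallImage`
for every sign from `Rank1Residual.FineSelmer.CoatesSujathaConjectureA` (Coates–Sujatha 2005, all
number fields — here used at `K = ℚ` only) and the binders `hCK`, `h12`, `h41`, `h5`, `h3`.  The node
is an OPEN conjecture (`@[conjecture] def`, nothing asserted); this theorem is a conditional bridge,
not a closure. [cite: CoatesSujatha2005, Conjecture A] [cite: Kobayashi2003, Thm. 7.4 (p. 13)] -/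
theorem stub_saturationSmallImage_of_coatesSujathaConjectureA
    (hA : Summit.BirchSwinnertonDyer.Rank1Residual.FineSelmer.CoatesSujathaConjectureA)
    (hCK : thm62_63_73_signedColemanKato_zeta)
    (h12 : Kobayashi2003.thm12_signedSelmerDual_finite_torsion)
    (h41 : Kobayashi2003.thm41_signedCharIdeal_divisibility)
    (h5 : realPeriodRat_eq_unit_mul_plusPeriod) (h3 : realPeriodRat_eq_unit_mul_plusPeriod_three) :
    ∀ (W : WeierstrassCurve ℚ) [W.IsElliptic] [W.IsGloballyMinimal] (p : ℕ) [Fact p.Prime],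
      p ≠ 2 → ClassX7 W p → ¬ W.HasCM → W.frobeniusTrace p = 0 → ¬ Surj W p →
      ∀ ε : ℤˣ, Summit.BirchSwinnertonDyer.Rank1Residual.Supersingular.KobayashiLowerDivisibility W p ε →
        Summit.BirchSwinnertonDyer.Rank1Residual.Supersingular.KobayashiMainConjecture W p ε :=
  stub_saturationSmallImage_of_conjectureA hCK h12 h41 h5 h3
    fun W _ _ p _ hp _ _ _ _ κ hκ ↦ hA ℚ W p hp κ hκ

/-! ### §3 Crux 4 BY NAME from its registered Eisenstein stub and Conjecture A on the domain -/

/-- **Crux 4 `KobayashiMainConjectureSmallImage` BY NAME** ⟸ the statement of the registered stub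
`stub_lowerSmallImage` (the Eisenstein half at small image — OPEN, no engine in print) + Coates–Sujatha's
Conjecture A on item 4's domain (node spelling) + the binders `hCK`, `h12`, `h41`, `h5`, `h3`.  The
analogue of part 5's `kobayashiMainConjectureSmallImage_of_lower_of_signedMuAn_oneSign` (p536189) with
the analytic rider replaced by the weaker algebraic one.  Nothing booked; crux 4 stays OPEN.
[cite: Kobayashi2003, Thm. 1.2 (p. 2), Thm. 4.1 (p. 8), Thm. 7.4 (p. 13)] [cite: CoatesSujatha2005, Conjecture A] -/
theorem kobayashiMainConjectureSmallImage_of_lower_of_conjectureA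
    (hCK : thm62_63_73_signedColemanKato_zeta)
    (h12 : Kobayashi2003.thm12_signedSelmerDual_finite_torsion)
    (h41 : Kobayashi2003.thm41_signedCharIdeal_divisibility)
    (h5 : realPeriodRat_eq_unit_mul_plusPeriod) (h3 : realPeriodRat_eq_unit_mul_plusPeriod_three)
    (hlower : ∀ (W : WeierstrassCurve ℚ) [W.IsElliptic] [W.IsGloballyMinimal] (p : ℕ) [Fact p.Prime],
      p ≠ 2 → ClassX7 W p → ¬ W.HasCM → W.frobeniusTrace p = 0 → ¬ Surj W p →
      ∃ ε : ℤˣ, Summit.BirchSwinnertonDyer.Rank1Residual.Supersingular.KobayashiLowerDivisibility W p ε)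
    (hA : ∀ (W : WeierstrassCurve ℚ) [W.IsElliptic] [W.IsGloballyMinimal] (p : ℕ) [Fact p.Prime],
      p ≠ 2 → ClassX7 W p → ¬ W.HasCM → W.frobeniusTrace p = 0 → ¬ Surj W p →
      ∀ (κ : ZpExtension ℚ p), κ.IsCyclotomic →
        ∃ (γ : absoluteGaloisGroup ℚ) (Y : W.FineSelmerDualData κ γ),
          Module.Finite ℤ_[p] (RestrictScalars ℤ_[p] (IwasawaAlgebra p) Y.X)) :
    Summit.BirchSwinnertonDyer.BirchSwinnertonDyer.Theses.SignedLowerHalves.KobayashiMainConjectureSmallImage := by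
  intro W _ _ p _ hp hX hcm hap hs
  obtain ⟨ε, hε⟩ := hlower W p hp hX hcm hap hs
  exact ⟨ε, stub_saturationSmallImage_of_conjectureA hCK h12 h41 h5 h3 hA W p hp hX hcm hap hs ε hε⟩

/-- **Crux 4 BY NAME from the registered Eisenstein stub and the tree's conjecture NODE by name**
(`Rank1Residual.FineSelmer.CoatesSujathaConjectureA`), with the binders `hCK`, `h12`, `h41`, `h5`,
`h3`.  A conditional bridge, not a closure. [cite: CoatesSujatha2005, Conjecture A] [cite: Kobayashi2003, Thm. 7.4 (p. 13)] -/
theorem kobayashiMainConjectureSmallImage_of_lower_of_coatesSujathaConjectureA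
    (hA : Summit.BirchSwinnertonDyer.Rank1Residual.FineSelmer.CoatesSujathaConjectureA)
    (hCK : thm62_63_73_signedColemanKato_zeta)
    (h12 : Kobayashi2003.thm12_signedSelmerDual_finite_torsion)
    (h41 : Kobayashi2003.thm41_signedCharIdeal_divisibility)
    (h5 : realPeriodRat_eq_unit_mul_plusPeriod) (h3 : realPeriodRat_eq_unit_mul_plusPeriod_three)
    (hlower : ∀ (W : WeierstrassCurve ℚ) [W.IsElliptic] [W.IsGloballyMinimal] (p : ℕ) [Fact p.Prime],
      p ≠ 2 → ClassX7 W p → ¬ W.HasCM → W.frobeniusTrace p = 0 → ¬ Surj W p →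
      ∃ ε : ℤˣ, Summit.BirchSwinnertonDyer.Rank1Residual.Supersingular.KobayashiLowerDivisibility W p ε) :
    Summit.BirchSwinnertonDyer.BirchSwinnertonDyer.Theses.SignedLowerHalves.KobayashiMainConjectureSmallImage :=
  kobayashiMainConjectureSmallImage_of_lower_of_conjectureA hCK h12 h41 h5 h3 hlower
    fun W _ _ p _ hp _ _ _ _ κ hκ ↦ hA ℚ W p hp κ hκ

end Summit.BirchSwinnertonDyer.BirchSwinnertonDyer.Theorems.SmallImageSignedMuDefect

end
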